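import Mathlib
import Summits.ValiantsHypothesis.ValiantsHypothesis.Theses.GrenetZeon
import Summits.ValiantsHypothesis.ValiantsHypothesis.Theorems.GrenetZeonTwoDimCoefficientsScalingIndexReducingSubspace
import Summits.ValiantsHypothesis.ValiantsHypothesis.Theorems.GrenetZeonTwoDimCoefficientsDualUnipotentRankTransfer

/-!
# Crux `GrenetZeon.TwoDimCoefficients` (stmt-ValiantsHypothesis-8062) / rung `DualUnipotentThreeHalves` (stmt-24318):
# scaling-closure — the 3/2 rung `n³ ≤ 4m²` BY NAME, modulo ONE hypothesis (T4 of memo EIGHTEENTH-HAND.md)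

Assembly of the eighteenth hand's results into the route's currency.  Unconditionally (✓ `cube_le_two_mul_sq_of_index`,
p835662) every unipotent dual representation whose nilpotent part `N` has nil-index `≤ n` satisfies `n³ ≤ 2m²`; for
nil-index `> n` the kernel bridge (✓ `sq_sub_mul_le_of_indexReducingSubst`, p836011) needs a PER-GENERIC INDEX-REDUCING
SUBSTITUTION.  The hypothesis `hT4` below is exactly that existence statement (inlined — a statement of this development,
NOT a published fact, no definition introduced): for every unipotent dual representation (`n ≥ 3`) in nilpotent-pencil form
`A = A₀(1 − N)` with `Nⁿ ≠ 0` there are a linear substitution `T` of the `n²` variables with `(N ∘ T)ⁿ = 0` and corank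
`≤ κ`, and a point `T w` at which `per_n` has Hessian rank `≥ n² − κ′`, with `2(κ′ + 2κ) ≤ n²`.

* `exists_pencilData` — every affine `A` with `det A = c ≠ 0` is `A₀(1 − N)` with
  `A₀` invertible and `N` a matrix of linear forms (the data the scaling-closure files take as input);
* ★★ `threeHalves_of_perGenericIndexReduction` — `hT4 ⟹ ∀ n ≥ 3, DualUnipotentRepr n m → n³ ≤ 4m²`;
* ★★ `dualUnipotentThreeHalves_of_perGenericIndexReduction` — `hT4 ⟹ Theses.GrenetZeon.DualUnipotentThreeHalves`
  (the route decl BY NAME, `C = 4`, `n₀ = 3`).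

HONEST FRAMING: CONDITIONAL on `hT4` (open; König subspaces show its genericity clause cannot be dropped; tame pencils of
any index are covered independently by ✓ `sq_le_of_trace_pow_mul_strictUpper`).  Item 24318 is NOT closed by this file; the
stub `DualUnipotentBound`, crux 8062 and `VP ≠ VNP` remain open.

References: T. Mignon, N. Ressayre, Int. Math. Res. Not. 2004:79, Thm. 1.1 (via the tree); folklore.
-/

-- single-conjunct layout `Summits/ValiantsHypothesis/ValiantsHypothesis`: the duplicated namespace
-- component is mandated by the tree.
set_option linter.dupNamespace false
set_option autoImplicit false

noncomputable section

namespace Summit.ValiantsHypothesis.ValiantsHypothesis.Theorems.GrenetZeonTwoDimCoefficients.ScalingClosure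

open MvPolynomial Matrix
open Literature.Computability.AlgebraicComplexity
open Literature.Algebra.Polynomial
open Summit.ValiantsHypothesis.ValiantsHypothesis.Cruxes.TwoDimCoefficients.DimTwoCases

/-! ### Pencil data of an affine matrix with constant determinant -/

section PencilData

/-- ★ **Pencil data.**  An affine `m × m` matrix `A` with `det A = c ≠ 0` is `A₀(1 − N)` with `A₀ = A(0)` invertible
(`A₀P₀ = 1`) and `N` a matrix of linear forms. [folklore] -/
theorem exists_pencilData {n m : ℕ} (A : AffMat n m) (hA : IsAffine A) (c : ℂ) (hc : c ≠ 0)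
    (hdet : A.det = MvPolynomial.C c) :
    ∃ (A₀ P₀ : Matrix (Fin m) (Fin m) ℂ) (N : AffMat n m), A₀ * P₀ = 1 ∧ (∀ i j, (N i j).IsHomogeneous 1) ∧
      A = A₀.map MvPolynomial.C * (1 - N) := by
  classical
  set A₀ : Matrix (Fin m) (Fin m) ℂ := A.map constantCoeff with hA₀
  have hA₀det : A₀.det = c := by
    have h := RingHom.map_det (constantCoeff : MvPolynomial (Fin n × Fin n) ℂ →+* ℂ) A
    rw [hdet, constantCoeff_C, RingHom.mapMatrix_apply] at h
    exact h.symm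
  have hA₀u : IsUnit A₀.det := by rw [hA₀det]; exact isUnit_iff_ne_zero.2 hc
  set P₀ : Matrix (Fin m) (Fin m) ℂ := A₀⁻¹ with hP₀
  have hAP : A₀ * P₀ = 1 := Matrix.mul_nonsing_inv A₀ hA₀u
  have hPA : P₀ * A₀ = 1 := Matrix.nonsing_inv_mul A₀ hA₀u
  -- the linear part
  set A₁ : AffMat n m := Matrix.of fun i j => homogeneousComponent 1 (A i j) with hA₁
  have hAsplit : A = A₀.map MvPolynomial.C + A₁ := by
    apply Matrix.ext; intro i j
    rw [Matrix.add_apply, Matrix.map_apply, hA₁, Matrix.of_apply, hA₀, Matrix.map_apply, constantCoeff_eq]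
    exact eq_C_add_homogeneousComponent_one (hA i j)
  set N : AffMat n m := -(P₀.map MvPolynomial.C * A₁) with hN
  refine ⟨A₀, P₀, N, hAP, ?_, ?_⟩
  · intro i j
    rw [hN, Matrix.neg_apply, Matrix.mul_apply]
    refine (IsHomogeneous.sum _ _ _ fun l _ => ?_).neg
    rw [Matrix.map_apply, hA₁, Matrix.of_apply]
    simpa using (isHomogeneous_C (Fin n × Fin n) (P₀ i l)).mul (homogeneousComponent_isHomogeneous 1 (A l j))
  · rw [hN, sub_neg_eq_add, Matrix.mul_add, Matrix.mul_one, ← Matrix.mul_assoc, ← Matrix.map_mul, hAP,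
      Matrix.map_one MvPolynomial.C (map_zero _) (map_one _), Matrix.one_mul]
    exact hAsplit

end PencilData

/-! ### The conditional rung -/

section Conditional

/-- ★★ **T4 ⟹ `n³ ≤ 4m²` for every unipotent dual representation (`n ≥ 3`).**  HYPOTHESIS `hT4` (per-generic
index-reducing substitution for pencils of nil-index `> n`; a statement of this development, open): see the module
docstring.  Index `≤ n`: ✓ `cube_le_two_mul_sq_of_index`; index `> n`: `hT4` + ✓ `sq_sub_mul_le_of_indexReducingSubst`.
[cite: MignonRessayre2004, Thm. 1.1 — via the tree; folklore] -/
theorem threeHalves_of_perGenericIndexReduction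
    (hT4 : ∀ (n m : ℕ) (A B : AffMat n m) (A₀ P₀ : Matrix (Fin m) (Fin m) ℂ) (N : AffMat n m) (α β c : ℂ),
      3 ≤ n → IsAffine A → IsAffine B → c ≠ 0 → β ≠ 0 → A.det = MvPolynomial.C c →
      perPoly (Fin n) ℂ = MvPolynomial.C α * A.det + MvPolynomial.C β * (A.adjugate * B).trace →
      A₀ * P₀ = 1 → (∀ i j, (N i j).IsHomogeneous 1) → A = A₀.map MvPolynomial.C * (1 - N) → N ^ n ≠ 0 →
      ∃ (T : Matrix (Fin n × Fin n) (Fin n × Fin n) ℂ) (w : Fin n × Fin n → ℂ) (κ κ' : ℕ),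
        (N.map (bind₁ (linSubst T))) ^ n = 0 ∧ n ^ 2 ≤ T.rank + κ ∧
        n ^ 2 ≤ (hess0 (transl (T.mulVec w) (perPoly (Fin n) ℂ))).rank + κ' ∧ 2 * (κ' + 2 * κ) ≤ n ^ 2) :
    ∀ n : ℕ, 3 ≤ n → ∀ m : ℕ, DualUnipotentRepr n m → n ^ 3 ≤ 4 * m ^ 2 := by
  intro n hn m hrep
  obtain ⟨α, β, c, A, B, hA, hB, hc, hdet, hper⟩ := hrep
  have hβ : β ≠ 0 := by
    intro hβ0
    apply perPoly_ne_C (n := n) (by omega) (α * c)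
    rw [hper, hdet, hβ0, map_zero, zero_mul, add_zero, ← map_mul]
  obtain ⟨A₀, P₀, N, hP₀, hN, hAN⟩ := exists_pencilData A hA c hc hdet
  by_cases hNn : N ^ n = 0
  · -- nil-index ≤ n: the unconditional theorem
    obtain ⟨k, rfl⟩ : ∃ k, n = k + 3 := ⟨n - 3, by omega⟩
    have h := cube_le_two_mul_sq_of_index A B hA hB α β c hc hβ hdet hper A₀ P₀ hP₀ N hN hNn hAN
    omega
  · -- nil-index > n: the hypothesis and the bridge
    obtain ⟨T, w, κ, κ', hTn, hκ, hκ', hsum⟩ :=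
      hT4 n m A B A₀ P₀ N α β c hn hA hB hc hβ hdet hper hP₀ hN hAN hNn
    have h := sq_sub_mul_le_of_indexReducingSubst (by omega) A B hA hB α β c hc hβ hdet hper A₀ P₀ hP₀ N hN hAN T
      hTn hκ w hκ'
    have h1 : n ^ 2 ≤ 2 * (n ^ 2 - κ' - 2 * κ) := by omega
    calc n ^ 3 = n ^ 2 * n := by ring
      _ ≤ 2 * (n ^ 2 - κ' - 2 * κ) * n := Nat.mul_le_mul_right _ h1
      _ = 2 * ((n ^ 2 - κ' - 2 * κ) * n) := by ring
      _ ≤ 2 * (2 * m ^ 2) := Nat.mul_le_mul_left _ h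
      _ = 4 * m ^ 2 := by ring

/-- ★★ **T4 ⟹ the route decl `DualUnipotentThreeHalves` (stmt-24318) BY NAME**, with `C = 4`, `n₀ = 3`.  CONDITIONAL on
`hT4` (open). [cite: MignonRessayre2004, Thm. 1.1 — via the tree; folklore] -/
theorem dualUnipotentThreeHalves_of_perGenericIndexReduction
    (hT4 : ∀ (n m : ℕ) (A B : AffMat n m) (A₀ P₀ : Matrix (Fin m) (Fin m) ℂ) (N : AffMat n m) (α β c : ℂ),
      3 ≤ n → IsAffine A → IsAffine B → c ≠ 0 → β ≠ 0 → A.det = MvPolynomial.C c →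
      perPoly (Fin n) ℂ = MvPolynomial.C α * A.det + MvPolynomial.C β * (A.adjugate * B).trace →
      A₀ * P₀ = 1 → (∀ i j, (N i j).IsHomogeneous 1) → A = A₀.map MvPolynomial.C * (1 - N) → N ^ n ≠ 0 →
      ∃ (T : Matrix (Fin n × Fin n) (Fin n × Fin n) ℂ) (w : Fin n × Fin n → ℂ) (κ κ' : ℕ),
        (N.map (bind₁ (linSubst T))) ^ n = 0 ∧ n ^ 2 ≤ T.rank + κ ∧
        n ^ 2 ≤ (hess0 (transl (T.mulVec w) (perPoly (Fin n) ℂ))).rank + κ' ∧ 2 * (κ' + 2 * κ) ≤ n ^ 2) :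
    Summit.ValiantsHypothesis.ValiantsHypothesis.Theses.GrenetZeon.DualUnipotentThreeHalves := by
  unfold Summit.ValiantsHypothesis.ValiantsHypothesis.Theses.GrenetZeon.DualUnipotentThreeHalves
  refine ⟨4, 3, fun n hn m hrep => ?_⟩
  exact threeHalves_of_perGenericIndexReduction hT4 n hn m hrep

end Conditional

end Summit.ValiantsHypothesis.ValiantsHypothesis.Theorems.GrenetZeonTwoDimCoefficients.ScalingClosure

end
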